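import Summits.HubbardSuperconductivity.HubbardSuperconductivity.Theorems.AnisotropyChordTransferFibre3RowDPairs

/-!
# Route `AnisotropyChord` / H0 rotor rung, row D (KT-2a) Stage-1 evaluator: SMALL `θ`-scaled pairs (the `O(θ)` factors)

Companion of `…RowDPairs`.  In the closed atoms of `R̂′(k)` every surviving term carries EXACTLY TWO `O(θ)` factors (two gradient
weights `1 − e^{−iθm}` of a `c0form3` monomial, or the two prefactors `(e^{iθe} − 1)(e^{∓i(k·e)θ} − 1)` of the spectator form), so
`R̂′(k)/V²` is `O(t)` and the row-D quotient `ρ_k = R̂′(k)/(V²t)` must be formed WITHOUT dividing by the cell variable `t`.  This file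
types the `O(θ)` factors separately: a SMALL pair `(x, y)` denotes `t·x + i·θ·y` (`t = θ² = y₀`); the gradient weight is the small
pair `(ŵ, m·ŝ)` (`sweight`), a phase difference `e^{−iθm} − 1` is `(−ŵ, −m·ŝ)` (`sphaseSub1`); products: SMALL × SMALL = `t ×` ORDINARY
(`smulS`, the `t` dropped symbolically), ORDINARY × SMALL = SMALL (`pmulS`).  Exact evaluation lemmas: `seval_sweight`,
`seval_sphaseSub1`, `peval_smulS` (`θ² · peval (smulS p q) = seval p * seval q`), `seval_pmulS`, `seval_sadd`, `seval_sscale`.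
Prover seat `hubbard-h0-rotor-p1` g29 (route lead); helper for piece A = stmt-HubbardSuperconductivity-23918 of rung 19089
(`--supports`, helper class).  Nothing here proves superconductivity in the Hubbard model; computable definitions + eval lemmas for
ONE row of ONE conditional reduction; the rotor TARGET as originally worded stays FALSE (g15 verdict).  Tree imports only; no sorry.
-/

set_option linter.dupNamespace false
set_option autoImplicit false

open Literature.Analysis.ValidatedNumerics

namespace Summit.HubbardSuperconductivity.HubbardSuperconductivity.Theorems.AnisotropyChord.Transfer.Fibre3

namespace RowD

open RowC L2.N1

/-- the complex number denoted by a SMALL pair: `t·x + i·θ·y` with `t = θ²`. -/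
noncomputable def seval (θ : ℝ) (v : ℕ → ℝ) (p : RExpr × RExpr) : ℂ :=
  ((θ ^ 2 * p.1.eval v : ℝ) : ℂ) + Complex.I * (θ : ℂ) * ((p.2.eval v : ℝ) : ℂ)

/-- the gradient weight `1 − e^{−iθm} = t·ŵ + iθ·m·ŝ` as a small pair `(ŵ, m·ŝ)`. -/
def sweight (w s : RExpr) (m : ℤ) : RExpr × RExpr := (w, .mul (cst (m : ℚ)) s)

/-- the phase difference `e^{−iθm} − 1 = −(1 − e^{−iθm})` as a small pair `(−ŵ, −m·ŝ)`. -/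
def sphaseSub1 (w s : RExpr) (m : ℤ) : RExpr × RExpr := (.neg w, .neg (.mul (cst (m : ℚ)) s))

/-- sum of small pairs. -/
def sadd (p q : RExpr × RExpr) : RExpr × RExpr := (.add p.1 q.1, .add p.2 q.2)

/-- real scaling of a small pair. -/
def sscale (e : RExpr) (p : RExpr × RExpr) : RExpr × RExpr := (.mul e p.1, .mul e p.2)

/-- SMALL × SMALL with the factor `t` DROPPED: `(t x₁ + iθy₁)(t x₂ + iθy₂) = t·[(t x₁x₂ − y₁y₂) + iθ(x₁y₂ + y₁x₂)]`;
`smulS p q` is the ordinary pair in brackets. -/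
def smulS (p q : RExpr × RExpr) : RExpr × RExpr :=
  (.sub (.mul (.mul yT p.1) q.1) (.mul p.2 q.2), .add (.mul p.1 q.2) (.mul p.2 q.1))

/-- ORDINARY × SMALL = SMALL: `(x₁ + iθy₁)(t x₂ + iθy₂) = t(x₁x₂ − y₁y₂) + iθ(x₁y₂ + t·y₁x₂)`. -/
def pmulS (p q : RExpr × RExpr) : RExpr × RExpr :=
  (.sub (.mul p.1 q.1) (.mul p.2 q.2), .add (.mul p.1 q.2) (.mul (.mul yT p.2) q.1))

/-! ## Evaluation lemmas -/

section eval
variable (θ : ℝ) (v : ℕ → ℝ) (ht : v 0 = θ ^ 2)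

/-- `sadd`. -/
theorem seval_sadd (p q : RExpr × RExpr) : seval θ v (sadd p q) = seval θ v p + seval θ v q := by
  simp only [seval, sadd, RExpr.eval]; push_cast; ring

/-- `sscale`. -/
theorem seval_sscale (e : RExpr) (p : RExpr × RExpr) :
    seval θ v (sscale e p) = ((e.eval v : ℝ) : ℂ) * seval θ v p := by
  simp only [seval, sscale, RExpr.eval]; push_cast; ring

include ht in
/-- ★ SMALL × SMALL: `θ²·peval (smulS p q) = seval p · seval q`. -/
theorem peval_smulS (p q : RExpr × RExpr) :
    ((θ ^ 2 : ℝ) : ℂ) * peval θ v (smulS p q) = seval θ v p * seval θ v q := by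
  simp only [peval, seval, smulS, yT, RExpr.eval, ht]
  push_cast
  have hI : Complex.I * Complex.I = -1 := Complex.I_mul_I
  ring_nf
  rw [pow_two Complex.I, hI]
  ring

include ht in
/-- ★ ORDINARY × SMALL: `seval (pmulS p q) = peval p · seval q`. -/
theorem seval_pmulS (p q : RExpr × RExpr) : seval θ v (pmulS p q) = peval θ v p * seval θ v q := by
  simp only [peval, seval, pmulS, yT, RExpr.eval, ht]
  push_cast
  have hI : Complex.I * Complex.I = -1 := Complex.I_mul_I
  ring_nf
  rw [pow_two Complex.I, hI]
  ring

include ht in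
/-- ★ the gradient weight: `sweight ŵ ŝ m = 1 − e^{−iθm}`. -/
theorem seval_sweight (hθ : θ ≠ 0) (w s : RExpr) (m : ℤ)
    (hw : w.eval v = (1 - Real.cos (m * θ)) / θ ^ 2) (hs : (m : ℝ) * s.eval v = Real.sin (m * θ) / θ) :
    seval θ v (sweight w s m) = 1 - Complex.exp (-(Complex.I * (θ : ℂ) * (m : ℂ))) := by
  rw [← peval_pweight θ v ht hθ w s m hw hs]
  simp only [seval, peval, sweight, pweight, yT, cst, RExpr.eval, ht]

include ht in
/-- the phase difference: `sphaseSub1 ŵ ŝ m = e^{−iθm} − 1`. -/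
theorem seval_sphaseSub1 (hθ : θ ≠ 0) (w s : RExpr) (m : ℤ)
    (hw : w.eval v = (1 - Real.cos (m * θ)) / θ ^ 2) (hs : (m : ℝ) * s.eval v = Real.sin (m * θ) / θ) :
    seval θ v (sphaseSub1 w s m) = Complex.exp (-(Complex.I * (θ : ℂ) * (m : ℂ))) - 1 := by
  have h := seval_sweight θ v ht hθ w s m hw hs
  simp only [seval, sweight, sphaseSub1, cst, RExpr.eval] at h ⊢
  push_cast at h ⊢
  linear_combination -h

end eval

end RowD

end Summit.HubbardSuperconductivity.HubbardSuperconductivity.Theorems.AnisotropyChord.Transfer.Fibre3
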